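import Summits.CriticalPhenomena.CardyFormulaZ2.Theses.CardyIKTransport
import Literature.Probability.Percolation.QuadCrossingSquareModel
import Literature.Probability.RandomPlanarGeometry.MarkedDomainCorners

/-!
# `RenewalGridHarmless` (stmt-CriticalPhenomena-4967), sandwich step 4: the two template
# families and their charts

Route `CardyIKTransport`, support item `RenewalGridHarmless`. For a conformal rectangle `R` with
square model `Φ` (Schoenflies, `IsSquareModel`) the sandwich uses two families of perturbed quads
(`perturbQuad`, Schramm–Smirnov's `Q^q`):

* the BULGED template `Q⁺_ε = Φ([-1+ε, 1-ε] × [-1-ε, 1+ε])` (chart `Φ`; its limit `ε = 0` has the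
  carrier AND the marked points of `R`: `carrier_perturbQuad_one`, `pt_perturbQuad_one`, via
  `apply_pt_of_isSquareModel` — a square model maps the corners of the square to the marked points);
* the CONJUGATE bulged template `Q†_ε = (Φ ∘ ρ)([-1+ε, 1-ε] × [-1-ε, 1+ε])`, `ρ z = i z` the
  quarter turn of the model square (chart `Φ ∘ ρ`): in the chart `Φ` it is the wide-and-short
  rectangle `[-1-ε, 1+ε] × [-1+ε, 1-ε]` with arc `0` its RIGHT side and arc `2` its LEFT side
  (`symm_re_im_of_mem_closure_rotTemplate`, `…_of_mem_arc_zero_rotTemplate`,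
  `…_of_mem_arc_two_rotTemplate`); its limit `ε = 0` has the carrier of `R` and the marked points of
  `R` shifted by one, `pt i = R.pt (i + 1)` (`carrier_perturbQuad_rot_one`, `pt_perturbQuad_rot_one`,
  via `image_mul_I_arc`: the quarter turn maps side `k` of the square onto side `k + 1`).

References: O. Schramm, S. Smirnov, Ann. Probab. 39 (2011) §5; V. Beffara, arXiv:0708.3908,
proof of Prop. 4 (conjugate marking); the tree's `QuadCrossingSquareModel.lean`,
`MarkedDomainCorners.lean`.
-/

noncomputable section

namespace Summit.CriticalPhenomena.CardyFormulaZ2.Theorems.CardyIKTransport.RenewalGridHarmless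

open Set Metric Complex
open Literature.Probability.Percolation
open Literature.Probability.LatticeModels
open Literature.Probability.RandomPlanarGeometry

/-! ### A square model maps corners to marked points -/

/-- In `Fin 4`, `k + 3 + 1 = k`. [folklore] -/
theorem fin_add_three_add_one (k : Fin 4) : k + 3 + 1 = k := by
  rw [add_assoc]; exact add_eq_left.2 rfl

/-- **A square model maps the corners of the square to the marked points**: `Φ (corner k) = R.pt k`
(the corner is the common point of sides `k-1`, `k`; its image is a common point of the arcs
`k-1`, `k`, which is a marked point, and not `R.pt (k-1)`). [folklore] -/
theorem apply_pt_of_isSquareModel {R : ConformalRectangle} {Φ : ℂ ≃ₜ ℂ} (h : IsSquareModel R Φ)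
    (k : Fin 4) : Φ (unitSquareQuad.pt k) = R.pt k := by
  have h1 : Φ (unitSquareQuad.pt k) ∈ R.arc k := by
    rw [← h.image_arc k]; exact mem_image_of_mem _ (unitSquareQuad.pt_mem_arc_self k)
  have h2 : Φ (unitSquareQuad.pt k) ∈ R.arc (k + 3) := by
    rw [← h.image_arc (k + 3)]
    refine mem_image_of_mem _ ?_
    have := unitSquareQuad.pt_succ_mem_arc (k + 3)
    rwa [fin_add_three_add_one] at this
  have hne : k ≠ k + 3 := by fin_cases k <;> decide
  rcases R.mem_arc_inter_arc hne h2 h1 with e | e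
  · exfalso
    have hmem : R.pt (k + 3) ∈ R.arc k := e ▸ h1
    rcases (R.pt_mem_arc_iff).1 hmem with h' | h'
    · revert h'; fin_cases k <;> decide
    · revert h'; fin_cases k <;> decide
  · rwa [fin_add_three_add_one] at e

/-- The unperturbed quad of the bulged family has the carrier of `R`. [folklore] -/
theorem carrier_perturbQuad_one {R : ConformalRectangle} {Φ : ℂ ≃ₜ ℂ} (h : IsSquareModel R Φ) :
    (perturbQuad Φ (-1) 1 (-1) 1 (by norm_num) (by norm_num)).carrier = R.carrier := by
  rw [perturbQuad, MarkedDomain.carrier_map]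
  exact h.image_carrier

/-- The unperturbed quad of the bulged family has the marked points of `R`. [folklore] -/
theorem pt_perturbQuad_one {R : ConformalRectangle} {Φ : ℂ ≃ₜ ℂ} (h : IsSquareModel R Φ)
    (i : Fin 4) : (perturbQuad Φ (-1) 1 (-1) 1 (by norm_num) (by norm_num)).pt i = R.pt i := by
  rw [perturbQuad, MarkedDomain.pt_map]
  exact apply_pt_of_isSquareModel h i

/-! ### The quarter turn of the model square -/

/-- Membership in the arcs of the model square `(-1,1)²`, all four sides. [folklore] -/
theorem mem_unitSquareQuad_arc_iff (k : Fin 4) (z : ℂ) :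
    z ∈ unitSquareQuad.arc k ↔
      (k = 0 ∧ z.im = -1 ∧ z.re ∈ Icc (-1 : ℝ) 1) ∨ (k = 1 ∧ z.re = 1 ∧ z.im ∈ Icc (-1 : ℝ) 1) ∨
        (k = 2 ∧ z.im = 1 ∧ z.re ∈ Icc (-1 : ℝ) 1) ∨ (k = 3 ∧ z.re = -1 ∧ z.im ∈ Icc (-1 : ℝ) 1) := by
  fin_cases k
  · simp only [Fin.zero_eta, Fin.isValue, true_and, zero_ne_one, false_and, or_false,
      Fin.reduceEq, or_self]
    exact mem_rectQuad_arc_zero (by norm_num) (by norm_num)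
  · simp only [Fin.mk_one, Fin.isValue, one_ne_zero, false_and, true_and, false_or, Fin.reduceEq,
      or_false]
    exact mem_rectQuad_arc_one (by norm_num) (by norm_num)
  · simp only [Fin.reduceFinMk, Fin.isValue, Fin.reduceEq, false_and, true_and, false_or, or_false]
    exact mem_rectQuad_arc_two (by norm_num) (by norm_num)
  · simp only [Fin.reduceFinMk, Fin.isValue, Fin.reduceEq, false_and, true_and, false_or]
    exact mem_rectQuad_arc_three (by norm_num) (by norm_num)

/-- **The quarter turn `z ↦ i z` maps side `k` of the model square onto side `k + 1`.** [folklore] -/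
theorem image_mul_I_arc (k : Fin 4) :
    (fun z : ℂ => I * z) '' unitSquareQuad.arc k = unitSquareQuad.arc (k + 1) := by
  ext w
  simp only [mem_image]
  constructor
  · rintro ⟨z, hz, rfl⟩
    rw [mem_unitSquareQuad_arc_iff] at hz ⊢
    simp only [Complex.mul_re, Complex.mul_im, Complex.I_re, Complex.I_im, zero_mul, one_mul,
      zero_sub, zero_add]
    rcases hz with ⟨rfl, h1, h2⟩ | ⟨rfl, h1, h2⟩ | ⟨rfl, h1, h2⟩ | ⟨rfl, h1, h2⟩
    · exact Or.inr (Or.inl ⟨rfl, by rw [h1]; norm_num, h2⟩)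
    · exact Or.inr (Or.inr (Or.inl ⟨rfl, h1, ⟨by linarith [h2.2], by linarith [h2.1]⟩⟩))
    · exact Or.inr (Or.inr (Or.inr ⟨rfl, by rw [h1], h2⟩))
    · refine Or.inl ⟨by decide, h1, ⟨by linarith [h2.2], by linarith [h2.1]⟩⟩
  · intro hw
    refine ⟨-I * w, ?_, by rw [← mul_assoc]; simp⟩
    rw [mem_unitSquareQuad_arc_iff] at hw ⊢
    simp only [neg_mul, Complex.neg_re, Complex.neg_im, Complex.mul_re, Complex.mul_im,
      Complex.I_re, Complex.I_im, zero_mul, one_mul, zero_sub, zero_add, neg_neg]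
    rcases hw with ⟨hk, h1, h2⟩ | ⟨hk, h1, h2⟩ | ⟨hk, h1, h2⟩ | ⟨hk, h1, h2⟩
    · have : k = 3 := by revert hk; fin_cases k <;> decide
      subst this
      exact Or.inr (Or.inr (Or.inr ⟨rfl, by rw [h1], ⟨by linarith [h2.2], by linarith [h2.1]⟩⟩))
    · have : k = 0 := by revert hk; fin_cases k <;> decide
      subst this
      exact Or.inl ⟨rfl, by rw [h1], h2⟩
    · have : k = 1 := by revert hk; fin_cases k <;> decide
      subst this
      exact Or.inr (Or.inl ⟨rfl, h1, ⟨by linarith [h2.2], by linarith [h2.1]⟩⟩)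
    · have : k = 2 := by revert hk; fin_cases k <;> decide
      subst this
      exact Or.inr (Or.inr (Or.inl ⟨rfl, by rw [h1]; norm_num, h2⟩))

/-- The quarter turn maps the open model square onto itself. [folklore] -/
theorem image_mul_I_carrier :
    (fun z : ℂ => I * z) '' unitSquareQuad.carrier = unitSquareQuad.carrier := by
  rw [unitSquareQuad_carrier]
  ext w
  simp only [mem_image, Complex.mem_reProdIm, mem_Ioo]
  constructor
  · rintro ⟨z, ⟨⟨h1, h2⟩, h3, h4⟩, rfl⟩
    simp only [Complex.mul_re, Complex.mul_im, Complex.I_re, Complex.I_im, zero_mul, one_mul,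
      zero_sub, zero_add]
    exact ⟨⟨by linarith, by linarith⟩, h1, h2⟩
  · rintro ⟨⟨h1, h2⟩, h3, h4⟩
    refine ⟨-I * w, ?_, by rw [← mul_assoc]; simp⟩
    simp only [neg_mul, Complex.neg_re, Complex.neg_im, Complex.mul_re, Complex.mul_im,
      Complex.I_re, Complex.I_im, zero_mul, one_mul, zero_sub, zero_add, neg_neg]
    exact ⟨⟨h3, h4⟩, by linarith, by linarith⟩

/-- The quarter-turn chart, read in `Φ`-coordinates: `((ρ.trans Φ)⁻¹ p).re = (Φ⁻¹ p).im` and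
`((ρ.trans Φ)⁻¹ p).im = -(Φ⁻¹ p).re`. [folklore] -/
theorem symm_rot_trans_re_im (Φ : ℂ ≃ₜ ℂ) (p : ℂ) :
    (((Homeomorph.mulLeft₀ I I_ne_zero).trans Φ).symm p).re = (Φ.symm p).im ∧
      (((Homeomorph.mulLeft₀ I I_ne_zero).trans Φ).symm p).im = -(Φ.symm p).re := by
  rw [Homeomorph.symm_trans_apply, Homeomorph.mulLeft₀_symm_apply, Complex.inv_I]
  simp

/-- The unperturbed quad of the conjugate family has the carrier of `R`. [folklore] -/
theorem carrier_perturbQuad_rot_one {R : ConformalRectangle} {Φ : ℂ ≃ₜ ℂ} (h : IsSquareModel R Φ) :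
    (perturbQuad ((Homeomorph.mulLeft₀ I I_ne_zero).trans Φ) (-1) 1 (-1) 1 (by norm_num)
      (by norm_num)).carrier = R.carrier := by
  rw [perturbQuad, MarkedDomain.carrier_map]
  have e : (⇑((Homeomorph.mulLeft₀ I I_ne_zero).trans Φ)) = Φ ∘ (fun z : ℂ => I * z) := by
    funext z; rfl
  rw [e, image_comp]
  change Φ '' ((fun z : ℂ => I * z) '' unitSquareQuad.carrier) = R.carrier
  rw [image_mul_I_carrier, h.image_carrier]

/-- **The unperturbed quad of the conjugate family has the marked points of `R` shifted by one**:
`pt i = R.pt (i + 1)`. [folklore] -/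
theorem pt_perturbQuad_rot_one {R : ConformalRectangle} {Φ : ℂ ≃ₜ ℂ} (h : IsSquareModel R Φ)
    (i : Fin 4) :
    (perturbQuad ((Homeomorph.mulLeft₀ I I_ne_zero).trans Φ) (-1) 1 (-1) 1 (by norm_num)
      (by norm_num)).pt i = R.pt (i + 1) := by
  rw [perturbQuad, MarkedDomain.pt_map, Homeomorph.trans_apply, Homeomorph.coe_mulLeft₀]
  change Φ (I * unitSquareQuad.pt i) = R.pt (i + 1)
  have h1 : Φ (I * unitSquareQuad.pt i) ∈ R.arc (i + 1) := by
    rw [← h.image_arc (i + 1), ← image_mul_I_arc i]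
    exact mem_image_of_mem _ (mem_image_of_mem _ (unitSquareQuad.pt_mem_arc_self i))
  have h2 : Φ (I * unitSquareQuad.pt i) ∈ R.arc i := by
    rw [← h.image_arc i]
    have e : i + 3 + 1 = i := fin_add_three_add_one i
    have := image_mul_I_arc (i + 3)
    rw [e] at this
    rw [← this]
    refine mem_image_of_mem _ (mem_image_of_mem _ ?_)
    have := unitSquareQuad.pt_succ_mem_arc (i + 3)
    rwa [e] at this
  have hne : i + 1 ≠ i := by fin_cases i <;> decide
  rcases R.mem_arc_inter_arc hne h2 h1 with e | e
  · exfalso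
    have hmem : R.pt i ∈ R.arc (i + 1) := e ▸ h1
    rcases (R.pt_mem_arc_iff).1 hmem with h' | h'
    · revert h'; fin_cases i <;> decide
    · revert h'; fin_cases i <;> decide
  · exact e

/-! ### Charts of the conjugate template -/

section RotTemplate

variable {Φ : ℂ ≃ₜ ℂ} {ε : ℝ} (hε0 : 0 < ε) (hε1 : ε < 1)

/-- Chart of the closed conjugate template `(Φ ∘ ρ)([-1+ε,1-ε] × [-1-ε,1+ε])` in `Φ`-coordinates:
the wide-and-short closed rectangle `[-1-ε, 1+ε] × [-1+ε, 1-ε]`. [folklore] -/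
theorem symm_re_im_of_mem_closure_rotTemplate {p : ℂ}
    (hp : p ∈ closure (perturbQuad ((Homeomorph.mulLeft₀ I I_ne_zero).trans Φ) (-1 + ε) (1 - ε)
      (-1 - ε) (1 + ε) (by linarith) (by linarith)).carrier) :
    (Φ.symm p).re ∈ Icc (-1 - ε) (1 + ε) ∧ (Φ.symm p).im ∈ Icc (-1 + ε) (1 - ε) := by
  rw [mem_closure_perturbQuad_carrier] at hp
  obtain ⟨hre, him⟩ := symm_rot_trans_re_im Φ p
  rw [hre, him] at hp
  exact ⟨⟨by linarith [hp.2.2], by linarith [hp.2.1]⟩, hp.1⟩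

/-- Chart of arc `0` of the conjugate template in `Φ`-coordinates: the RIGHT side `re = 1 + ε`.
[folklore] -/
theorem symm_re_im_of_mem_arc_zero_rotTemplate {p : ℂ}
    (hp : p ∈ (perturbQuad ((Homeomorph.mulLeft₀ I I_ne_zero).trans Φ) (-1 + ε) (1 - ε)
      (-1 - ε) (1 + ε) (by linarith) (by linarith)).arc 0) :
    (Φ.symm p).re = 1 + ε ∧ (Φ.symm p).im ∈ Icc (-1 + ε) (1 - ε) := by
  rw [mem_perturbQuad_arc_zero] at hp
  obtain ⟨hre, him⟩ := symm_rot_trans_re_im Φ p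
  rw [hre, him] at hp
  exact ⟨by linarith [hp.1], hp.2⟩

/-- Chart of arc `2` of the conjugate template in `Φ`-coordinates: the LEFT side `re = -1 - ε`.
[folklore] -/
theorem symm_re_im_of_mem_arc_two_rotTemplate {p : ℂ}
    (hp : p ∈ (perturbQuad ((Homeomorph.mulLeft₀ I I_ne_zero).trans Φ) (-1 + ε) (1 - ε)
      (-1 - ε) (1 + ε) (by linarith) (by linarith)).arc 2) :
    (Φ.symm p).re = -1 - ε ∧ (Φ.symm p).im ∈ Icc (-1 + ε) (1 - ε) := by
  rw [mem_perturbQuad_arc_two] at hp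
  obtain ⟨hre, him⟩ := symm_rot_trans_re_im Φ p
  rw [hre, him] at hp
  exact ⟨by linarith [hp.1], hp.2⟩

end RotTemplate

end Summit.CriticalPhenomena.CardyFormulaZ2.Theorems.CardyIKTransport.RenewalGridHarmless

end
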